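import Summits.PneNP.PneNP.Theses.KarlinRubin

/-!
# Route KarlinRubin — `MonotoneSuffices` (stmt-PneNP-18026): structural lemmas

`MonotoneSuffices` (X₁ of route KarlinRubin) says: for every `δ ∈ (0,1/2)` there is an exponent `a`
such that for EVERY size budget `s`, a strongly detecting `B₂`-family of size `≤ s(n)` for the
planted `⌈n^{1/2-δ}⌉`-clique at density `1/2` can be replaced by a strongly detecting
`{∧₂, ∨₂, 0, 1}`-family of size `≤ (s(n)+n)^a`.

This file records the elementary logical structure of the item (helpers, `--supports`):

* `karlinRubin_monotoneSuffices_of_monotone_detectors` — if at every `δ ∈ (0,1/2)` SOME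
  polynomial-size monotone family strongly detects, then `MonotoneSuffices` holds outright
  (with `a` the detector's exponent, ignoring the hypothesis);
* `karlinRubin_monotoneBlindAt_of_not_monotoneSuffices` — contrapositive: any refutation of
  `MonotoneSuffices` yields a `δ ∈ (0,1/2)` at which NO polynomial-size monotone family strongly
  detects, i.e. an instance of the route's other crux `MonotoneBlind` (an average-case monotone
  lower bound for the noisy planted clique at `p = 1/2`, of which none is in print);
* `karlinRubin_monotoneSuffices_or_monotoneBlindAt` — the resulting unconditional dichotomy.
-/

set_option linter.dupNamespace false -- `Summit.PneNP.PneNP.…`: summit = sub-problem name (D-0017 single-conjunct layout)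

namespace Summit.PneNP.PneNP.Theorems

open Filter Topology
open Literature.Computability.Complexity Literature.Probability.RandomGraphs.PlantedClique

/-- **`MonotoneSuffices` from monotone detectors.** If for every `δ ∈ (0,1/2)` some family of
`{∧₂, ∨₂, 0, 1}`-circuits of polynomial size strongly detects the planted `⌈n^{1/2-δ}⌉`-clique
(type-I + type-II error `→ 0`), then `MonotoneSuffices` holds: take `a` = the exponent of that
family; `n ^ a ≤ (s n + n) ^ a` for every budget `s`. [folklore] -/
theorem karlinRubin_monotoneSuffices_of_monotone_detectors
    (h : ∀ δ : ℝ, 0 < δ → δ < 1 / 2 → ∃ c : ℕ,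
      ∃ C : (n : ℕ) → Circuit ((⊤ : SimpleGraph (Fin n)).edgeSet),
        (∀ᶠ n : ℕ in atTop, (C n).IsOver monotoneBasis01 ∧ (C n).size ≤ n ^ c) ∧
        Tendsto (fun n : ℕ => (erdosRenyiHalf n).toOuterMeasure {x | (C n).eval x = true} +
          (plantedCliqueDist n ⌈(n : ℝ) ^ (1 / 2 - δ)⌉₊).toOuterMeasure {x | (C n).eval x = false})
          atTop (nhds 0)) :
    Summit.PneNP.PneNP.Theses.KarlinRubin.MonotoneSuffices := by
  intro δ hδ hδ'
  obtain ⟨c, C, hC, hT⟩ := h δ hδ hδ'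
  refine ⟨c, fun s _ => ⟨C, ?_, hT⟩⟩
  filter_upwards [hC] with n hn
  exact ⟨hn.1, hn.2.trans (Nat.pow_le_pow_left (Nat.le_add_left n (s n)) c)⟩

/-- **A refutation of `MonotoneSuffices` is a monotone lower bound.** If `MonotoneSuffices`
fails then at some `δ ∈ (0,1/2)` no polynomial-size family of `{∧₂, ∨₂, 0, 1}`-circuits strongly
detects the planted `⌈n^{1/2-δ}⌉`-clique — the route's crux `MonotoneBlind` at that `δ`.
[folklore] -/
theorem karlinRubin_monotoneBlindAt_of_not_monotoneSuffices
    (h : ¬ Summit.PneNP.PneNP.Theses.KarlinRubin.MonotoneSuffices) :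
    ∃ δ : ℝ, 0 < δ ∧ δ < 1 / 2 ∧ ∀ c : ℕ,
      ¬ ∃ C : (n : ℕ) → Circuit ((⊤ : SimpleGraph (Fin n)).edgeSet),
        (∀ᶠ n : ℕ in atTop, (C n).IsOver monotoneBasis01 ∧ (C n).size ≤ n ^ c) ∧
        Tendsto (fun n : ℕ => (erdosRenyiHalf n).toOuterMeasure {x | (C n).eval x = true} +
          (plantedCliqueDist n ⌈(n : ℝ) ^ (1 / 2 - δ)⌉₊).toOuterMeasure {x | (C n).eval x = false})
          atTop (nhds 0) := by
  by_contra hcon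
  push Not at hcon
  exact h (karlinRubin_monotoneSuffices_of_monotone_detectors
    fun δ hδ hδ' => hcon δ hδ hδ')

/-- **Dichotomy.** Unconditionally: either `MonotoneSuffices` holds, or at some `δ ∈ (0,1/2)` the
planted `⌈n^{1/2-δ}⌉`-clique at density `1/2` is invisible to every polynomial-size monotone
family (an instance of `MonotoneBlind`). [folklore] -/
theorem karlinRubin_monotoneSuffices_or_monotoneBlindAt :
    Summit.PneNP.PneNP.Theses.KarlinRubin.MonotoneSuffices ∨
    ∃ δ : ℝ, 0 < δ ∧ δ < 1 / 2 ∧ ∀ c : ℕ,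
      ¬ ∃ C : (n : ℕ) → Circuit ((⊤ : SimpleGraph (Fin n)).edgeSet),
        (∀ᶠ n : ℕ in atTop, (C n).IsOver monotoneBasis01 ∧ (C n).size ≤ n ^ c) ∧
        Tendsto (fun n : ℕ => (erdosRenyiHalf n).toOuterMeasure {x | (C n).eval x = true} +
          (plantedCliqueDist n ⌈(n : ℝ) ^ (1 / 2 - δ)⌉₊).toOuterMeasure {x | (C n).eval x = false})
          atTop (nhds 0) :=
  (em _).imp id karlinRubin_monotoneBlindAt_of_not_monotoneSuffices

end Summit.PneNP.PneNP.Theorems
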